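import Summits.QuantumFields.BalabanUV.T4Continuum.Support.AveragingDeficitPushForwardLinear
import Literature.MathematicalPhysics.QuantumFieldTheory.Balaban1983to89.B8Lemma1NonAbelian

/-!
# AveragingDeficitFaceWords (T⁴ programme, node NE3, row NE3-R2, gen 2) — FACE BONDS AND THE CONTOURS OF (42): the far
# face bond `b₀(c) = ⟨Ly + (L−1)e_κ, Ly + Le_κ⟩` of the central contour of the coarse bond `c = (y, κ)`, the arithmetic
# of face bonds, the classification «a face bond on a contour of `c` is `b₀(c)`», and the linearised transport of a
# FACE-SUPPORTED direction along the words of (42): `(δ_ψV)(Γ_c) = Ad_{V(Γ_c)}ψ(b₀)`,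
# `(δ_ψV)(Γ_{c,x} ∪ −Γ_c) = χ_x·Ad_{V(Γ_c)}ψ(b₀) − Ad_{V(Γ_{c,x})}ψ(b₀)` (file 3a of the non-abelian lift γ)

HONEST FRAMING (cell `pub-balaban`, T4-DAG PAGE 1; unit `b2b-balaban-t4-ne3r2-p1` = owner of BINDER-OWNERS row NE3-R2,
gen 2).  The cell's T4 target is the finite-torus continuum limit of the unit-scale averaged loop expectations — NOT
infinite volume, NO mass gap, NOT Clay, NOT summit progress.  Towards the lift γ of the NE3 energy route (record
`t4/T4-EST-NE3-P2.md` §4 (γ1)) this unit inverts the differential `ψ ↦ pushDir L V ψ` of Bałaban's average (42) on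
directions supported on ONE fine bond per coarse bond: the last bond `b₀(c)` of the central contour `Γ_c` before it
leaves the block `B(c₋)`.  THIS FILE is the combinatorics of that choice (all [folklore], 0 sorry): §1 face bonds
(`faceSite`, `IsFaceBond`, uniqueness, the residue arithmetic `face_coord`); §2 ON THE WORDS OF `c` THE ONLY FACE BOND IS
`b₀(c)`: tree words `Γ_{Ly,x}`, `Γ_{Ly+Le_κ,x+Le_κ}` carry none (`not_isFaceBond_of_mem_treeWord`, file 1's
`bondsOf_treeWord_lt`; one-axis tree words via the tree's `B8Lemma1NonAbelian.treeWord_zsmul_e`), the straight contour from `x = Ly + r` carries one iff `x` lies ON THE AXIS of `c` (`r ⊥ = 0`)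
and then it is `b₀(c)` (`face_of_mem_seg`), the central contour and its reverse carry exactly `b₀(c)`; §3 for a
FACE-SUPPORTED direction (`FaceSupported`: zero off face bonds) the transport derivatives along the words of (42):
`dhol_treeWord_eq_zero`, `dhol_central` (`= Ad_{P₀} m`, `P₀ = V(Γ_c)`, `m = ψ(b₀)`), `dhol_seg_offAxis = 0`,
`dhol_seg_onAxis`, `dhol_back = −m`, **`dhol_loopWord`** (`= χ·Ad_{P₀} m − Ad_{V(Γ_{c,x})} m`) and the dressed form
**`Ad_inv_Wcx_dhol_loopWord`** (`Ad_{W⁻¹}(δ loop) = χ·Ad_{W⁻¹}(Ad_{P₀}m) − Ad_{P₀}m`, using `W⁻¹V(Γ_{c,x}) = V(Γ_c)`);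
§4 **`pushDir_faceSupported`**: `Φ(c) = m + Ad_{P₀⁻¹} J_{X_c}(X_c′)`.  NE3 ITSELF IS NOT PROVED; NE3 stays COND-free.
CITATION HEADER: no printed sentence is a hypothesis; the manuscripts under audit are not cited for any disputed step;
context: T. Bałaban, Commun. Math. Phys. **98** (1985) 17–51 [Balaban1985Averaging] ((9) p. 18, (14) p. 19, (42) p. 23,
p. 24); **95** (1984) 17–40 [Balaban1984PropagatorsI] ((1.6)–(1.8) p. 18).  PLACEMENT: `Summits/QuantumFields/BalabanUV/`
(human rule 2026-08-19).  Record: HOME `t4/T4-EST-NE3-R2.md` v0.3.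
-/

set_option autoImplicit false

open scoped BigOperators Matrix Matrix.Norms.L2Operator Topology
open NormedSpace Finset Filter

namespace Summit.QuantumFields.BalabanUV.T4Continuum.AveragingDeficitFaceWords

open Literature.MathematicalPhysics.QuantumFieldTheory.Balaban1983to89
open B7Prop1Explicit B7Prop2Explicit MatrixLog UnitaryModel
open T4AveragingDeficitWall hiding Site Plane Plaq Bond
open T4AveragingDeficitNonAbelian (Ad_mul Ad_sub)
open AveragingDeficitTransport AveragingDeficitLocality AveragingDeficitNearIdentity AveragingDeficitSideDeriv
open AveragingDeficitResidualPairing AveragingDeficitTransportCalc AveragingDeficitPushForwardLinear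

noncomputable section

variable {d : ℕ} {n : Type*} [Fintype n] [DecidableEq n]

local notation "𝕄" => Matrix n n ℂ
local notation "Site" => B7Prop1Explicit.Site

/-! ## §1 Face bonds -/

/-- The initial point `Ly + (L−1)e_κ` of the far face bond `b₀(c)` of the central contour `Γ_c` of the coarse bond
`c = (y, κ)`. [cite: Balaban1984PropagatorsI, (1.6)–(1.8) p.18] -/
def faceSite (L : ℕ) (y : Site d) (κ : Fin d) : Site d := (L : ℤ) • y + ((L : ℤ) - 1) • e κ

/-- `(z, i)` is a face bond: `z = Ly + (L−1)e_i` for some coarse site `y`. [folklore] -/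
def IsFaceBond (L : ℕ) (z : Site d) (i : Fin d) : Prop := ∃ y : Site d, z = faceSite L y i

omit [Fintype n] [DecidableEq n] in
/-- `b₀(c)` is a face bond. [folklore] -/
theorem isFaceBond_faceSite (L : ℕ) (y : Site d) (κ : Fin d) : IsFaceBond L (faceSite L y κ) κ := ⟨y, rfl⟩

omit [Fintype n] [DecidableEq n] in
/-- The coarse site of a face bond is unique. [folklore] -/
theorem eq_of_faceSite_eq {L : ℕ} (hL : 1 ≤ L) {y y' : Site d} {κ : Fin d} (h : faceSite L y κ = faceSite L y' κ) :
    y = y' := by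
  unfold faceSite at h
  have h1 : (L : ℤ) • y = (L : ℤ) • y' := add_right_cancel h
  funext j
  have h2 := congr_fun h1 j
  simp only [Pi.smul_apply, smul_eq_mul] at h2
  have hL0 : (L : ℤ) ≠ 0 := by exact_mod_cast (by omega : L ≠ 0)
  exact mul_left_cancel₀ hL0 h2

omit [Fintype n] [DecidableEq n] in
/-- **RESIDUE ARITHMETIC OF FACE BONDS**: if `Ly + t = Ly′ + (L−1)e_i` and `0 ≤ t_j < L`, then `t_j = (L−1)·[j = i]`.
[folklore] -/
theorem face_coord {L : ℕ} (hL : 1 ≤ L) {y y' t : Site d} {i : Fin d}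
    (h : (L : ℤ) • y + t = faceSite L y' i) (j : Fin d) (ht0 : 0 ≤ t j) (htL : t j < L) :
    t j = if j = i then (L : ℤ) - 1 else 0 := by
  have hj := congr_fun h j
  simp only [faceSite, Pi.add_apply, Pi.smul_apply, smul_eq_mul, e_apply, mul_ite, mul_one, mul_zero] at hj
  have key : t j % (L : ℤ) = (if j = i then (L : ℤ) - 1 else 0) % (L : ℤ) := by
    have e1 : t j = (if j = i then (L : ℤ) - 1 else 0) + (y' j - y j) * (L : ℤ) := by
      split_ifs at hj ⊢ <;> linear_combination hj
    rw [e1, Int.add_mul_emod_self_right]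
  rw [Int.emod_eq_of_lt ht0 htL] at key
  rw [key]
  split_ifs
  · exact Int.emod_eq_of_lt (by omega) (by omega)
  · simp

/-! ## §2 On the words of `c` the only face bond is `b₀(c)` -/

omit [Fintype n] [DecidableEq n] in
/-- Block offsets are in `[0, L)`. [folklore] -/
theorem boxVec_bounds (L : ℕ) (r : Fin d → Fin L) (i : Fin d) : (0 : ℤ) ≤ boxVec L r i ∧ boxVec L r i < L := by
  simp only [boxVec]
  exact ⟨by positivity, by exact_mod_cast (r i).isLt⟩

omit [Fintype n] [DecidableEq n] in
/-- **Tree words carry no face bond** (base a block corner `Ly`). [cite: Balaban1985Averaging, p.24] -/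
theorem not_isFaceBond_of_mem_treeWord {L : ℕ} (hL : 1 ≤ L) (y : Site d) (r : Fin d → Fin L) {b : Site d × Fin d}
    (hb : b ∈ bondsOf ((L : ℤ) • y) (treeWord (boxVec L r))) : ¬ IsFaceBond L b.1 b.2 := by
  rintro ⟨y', hy'⟩
  obtain ⟨h1, h2⟩ := bondsOf_treeWord_lt _ (fun i => (boxVec_bounds L r i).1) _ b hb
  have ht : (L : ℤ) • y + (b.1 - (L : ℤ) • y) = faceSite L y' b.2 := by rw [add_sub_cancel, hy']
  have hrb := (boxVec_bounds L r b.2).2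
  simp only [Pi.smul_apply, smul_eq_mul] at h1 h2
  have := face_coord hL ht b.2 (by simp only [Pi.sub_apply, Pi.smul_apply, smul_eq_mul]; linarith)
    (by simp only [Pi.sub_apply, Pi.smul_apply, smul_eq_mul]; linarith)
  simp only [Pi.sub_apply, Pi.smul_apply, smul_eq_mul, if_true] at this
  linarith

/-- The axis predicate: the block point `x = Ly + r` lies on the axis of `c = (y, κ)` (`r ⊥ = 0`). [folklore] -/
def OnAxis (κ : Fin d) {L : ℕ} (r : Fin d → Fin L) : Prop := ∀ i, i ≠ κ → (r i : ℕ) = 0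

/-- `OnAxis` is decidable. [folklore] -/
instance instDecidableOnAxis (κ : Fin d) {L : ℕ} (r : Fin d → Fin L) : Decidable (OnAxis κ r) := by
  unfold OnAxis; infer_instance

omit [Fintype n] [DecidableEq n] in
/-- On the axis the block offset is `r_κ e_κ`. [folklore] -/
theorem boxVec_of_onAxis {κ : Fin d} {L : ℕ} {r : Fin d → Fin L} (hr : OnAxis κ r) :
    boxVec L r = ((r κ : ℕ) : ℤ) • e κ := by
  funext i
  simp only [boxVec, Pi.smul_apply, e_apply, smul_eq_mul, mul_ite, mul_one, mul_zero]
  split_ifs with h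
  · rw [h]
  · exact_mod_cast hr i h

omit [Fintype n] [DecidableEq n] in
/-- **The straight contour from `x = Ly + r` carries a face bond only on the axis, and then it is `b₀(c)`.**
[cite: Balaban1985Averaging, (14) p.19, (42) p.23] -/
theorem face_of_mem_seg {L : ℕ} (hL : 1 ≤ L) (y : Site d) (κ : Fin d) (r : Fin d → Fin L) {b : Site d × Fin d}
    (hb : b ∈ bondsOf ((L : ℤ) • y + boxVec L r) (seg κ (L : ℤ))) (hf : IsFaceBond L b.1 b.2) :
    OnAxis κ r ∧ b = (faceSite L y κ, κ) := by
  obtain ⟨j, hj, rfl⟩ := (mem_bondsOf_seg_iff _ κ L b).mp hb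
  obtain ⟨y', hy'⟩ := hf
  simp only at hy'
  set t : Site d := boxVec L r + (j : ℤ) • e κ with ht_def
  have ht : (L : ℤ) • y + t = faceSite L y' κ := by rw [ht_def, ← add_assoc, hy']
  -- transverse coordinates vanish
  have hperp : OnAxis κ r := by
    intro i hi
    have hb0 := boxVec_bounds L r i
    have := face_coord hL ht i (by simp [ht_def, e_apply, hi, hb0.1]) (by simp [ht_def, e_apply, hi, hb0.2])
    simp only [ht_def, Pi.add_apply, Pi.smul_apply, e_apply, if_neg hi, smul_eq_mul, mul_zero, add_zero] at this
    simp only [boxVec] at this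
    exact_mod_cast this
  -- the axial coordinate is `L − 1`
  have hrκ0 : (r κ : ℕ) < L := (r κ).isLt
  have hκ : ((r κ : ℕ) : ℤ) + j = (L : ℤ) - 1 := by
    have hb0 := boxVec_bounds L r κ
    by_cases hlt : boxVec L r κ + (j : ℤ) < L
    · have := face_coord hL ht κ (by simp [ht_def, e_apply]; linarith [hb0.1]) (by simpa [ht_def, e_apply] using hlt)
      simpa [ht_def, e_apply, boxVec] using this
    · -- shift the block: `Ly + t = L(y + e_κ) + (t − Le_κ)`
      have ht' : (L : ℤ) • (y + e κ) + (t - (L : ℤ) • e κ) = faceSite L y' κ := by rw [← ht, smul_add]; abel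
      have h0 : (0 : ℤ) ≤ (t - (L : ℤ) • e κ) κ := by
        simp only [ht_def, Pi.sub_apply, Pi.add_apply, Pi.smul_apply, e_apply, if_true, smul_eq_mul, mul_one]
        linarith
      have h1 : (t - (L : ℤ) • e κ) κ < L := by
        simp only [ht_def, Pi.sub_apply, Pi.add_apply, Pi.smul_apply, e_apply, if_true, smul_eq_mul, mul_one]
        have : (j : ℤ) < L := by exact_mod_cast hj
        linarith [hb0.2]
      have hfc := face_coord hL ht' κ h0 h1
      simp only [ht_def, Pi.sub_apply, Pi.add_apply, Pi.smul_apply, e_apply, if_true, smul_eq_mul, mul_one] at hfc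
      have hjL : (j : ℤ) < L := by exact_mod_cast hj
      have hbv : boxVec L r κ = ((r κ : ℕ) : ℤ) := rfl
      have hrL : ((r κ : ℕ) : ℤ) < L := by exact_mod_cast hrκ0
      omega
  refine ⟨hperp, ?_⟩
  simp only [Prod.mk.injEq, and_true, faceSite]
  rw [boxVec_of_onAxis hperp, add_assoc, ← add_smul, hκ]

omit [Fintype n] [DecidableEq n] in
/-- The central contour `Γ_c` carries exactly the face bond `b₀(c)`. [folklore] -/
theorem face_of_mem_central {L : ℕ} (hL : 1 ≤ L) (y : Site d) (κ : Fin d) {b : Site d × Fin d}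
    (hb : b ∈ bondsOf ((L : ℤ) • y) (seg κ (L : ℤ))) (hf : IsFaceBond L b.1 b.2) : b = (faceSite L y κ, κ) := by
  let r₀ : Fin d → Fin L := fun _ => ⟨0, hL⟩
  have hr₀ : boxVec L r₀ = 0 := by funext i; simp [boxVec, r₀]
  have hb' : b ∈ bondsOf ((L : ℤ) • y + boxVec L r₀) (seg κ (L : ℤ)) := by rw [hr₀, add_zero]; exact hb
  exact (face_of_mem_seg hL y κ r₀ hb' hf).2

omit [Fintype n] [DecidableEq n] in
/-- The reversed central contour (from `Ly + Le_κ`) carries exactly the face bond `b₀(c)`, as its FIRST bond (`j = 0`).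
[folklore] -/
theorem face_of_mem_back {L : ℕ} (hL : 1 ≤ L) (y : Site d) (κ : Fin d) {j : ℕ} (hj : j < L)
    (hf : IsFaceBond L ((L : ℤ) • y + (L : ℤ) • e κ - ((j : ℤ) + 1) • e κ) κ) : j = 0 := by
  obtain ⟨y', hy'⟩ := hf
  have ht : (L : ℤ) • y + (((L : ℤ) - (j + 1)) • e κ) = faceSite L y' κ := by rw [← hy', sub_smul]; abel
  have := face_coord hL ht κ (by simp [e_apply]; try omega) (by simp [e_apply]; try omega)
  simp only [Pi.smul_apply, e_apply, if_true, smul_eq_mul, mul_one] at this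
  omega

/-! ## §3 Face-supported directions along the words of (42) -/

/-- A direction SUPPORTED ON FACE BONDS: zero off the bonds `b₀(c)`. [folklore] -/
def FaceSupported (L : ℕ) (ψ : Site d → Fin d → 𝕄) : Prop := ∀ (z : Site d) (i : Fin d), ¬ IsFaceBond L z i → ψ z i = 0

/-- Tree words from a block corner: `(δ_ψV) = 0` for a face-supported `ψ`. [folklore] -/
theorem dhol_treeWord_eq_zero {L : ℕ} {V : Site d → Fin d → 𝕄ˣ} {ψ : Site d → Fin d → 𝕄} (hL : 1 ≤ L) (hψ : FaceSupported L ψ) (y : Site d) (r : Fin d → Fin L) :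
    dhol V ψ ((L : ℤ) • y) (treeWord (boxVec L r)) = 0 :=
  dhol_eq_zero_of_forall V _ _ fun _ hb => hψ _ _ (not_isFaceBond_of_mem_treeWord hL y r hb)

/-- The central contour: `(δ_ψV)(Γ_c) = Ad_{V(Γ_c)} ψ(b₀)`. [cite: Balaban1985Averaging, (9) p.18, (42) p.23] -/
theorem dhol_central {L : ℕ} {V : Site d → Fin d → 𝕄ˣ} {ψ : Site d → Fin d → 𝕄} (hL : 1 ≤ L) (hψ : FaceSupported L ψ) (y : Site d) (κ : Fin d) :
    dhol V ψ ((L : ℤ) • y) (seg κ (L : ℤ)) = Ad (hol V ((L : ℤ) • y) (seg κ (L : ℤ))) (ψ (faceSite L y κ) κ) := by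
  have h := dhol_seg_single V (ψ := ψ) ((L : ℤ) • y) κ (k := L) (j₀ := L - 1) (by omega) fun j hj hne =>
    hψ _ _ fun hf => hne ?_
  · rw [h, show ((L - 1 : ℕ) : ℤ) + 1 = (L : ℤ) by omega, show ((L - 1 : ℕ) : ℤ) = (L : ℤ) - 1 by omega]
    rfl
  · have hb : ((L : ℤ) • y + (j : ℤ) • e κ, κ) ∈ bondsOf ((L : ℤ) • y) (seg κ (L : ℤ)) :=
      (mem_bondsOf_seg_iff _ κ L _).mpr ⟨j, hj, rfl⟩
    have := face_of_mem_central hL y κ hb hf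
    simp only [Prod.mk.injEq, and_true, faceSite, add_right_inj] at this
    have := congr_fun this κ
    simp only [Pi.smul_apply, e_apply, if_true, smul_eq_mul, mul_one] at this
    omega

/-- A straight contour off the axis: `(δ_ψV) = 0`. [folklore] -/
theorem dhol_seg_offAxis {L : ℕ} {V : Site d → Fin d → 𝕄ˣ} {ψ : Site d → Fin d → 𝕄} (hL : 1 ≤ L) (hψ : FaceSupported L ψ) (y : Site d) (κ : Fin d) {r : Fin d → Fin L}
    (hr : ¬ OnAxis κ r) : dhol V ψ ((L : ℤ) • y + boxVec L r) (seg κ (L : ℤ)) = 0 :=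
  dhol_eq_zero_of_forall V _ _ fun _ hb => hψ _ _ fun hf => hr (face_of_mem_seg hL y κ r hb hf).1

/-- A straight contour ON the axis (`x = Ly + r_κe_κ`): `(δ_ψV) = Ad_{V(x, …, Ly + Le_κ)} ψ(b₀)`, and the dressing
completes the tree word to `V(Γ_c)`: `V(Γ_{Ly,x}) · V(x, …, Ly + Le_κ) = V(Γ_c)`. [folklore] -/
theorem dhol_seg_onAxis {L : ℕ} {V : Site d → Fin d → 𝕄ˣ} {ψ : Site d → Fin d → 𝕄} (hL : 1 ≤ L) (hψ : FaceSupported L ψ) (y : Site d) (κ : Fin d) {r : Fin d → Fin L}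
    (hr : OnAxis κ r) :
    Ad (hol V ((L : ℤ) • y) (treeWord (boxVec L r))) (dhol V ψ ((L : ℤ) • y + boxVec L r) (seg κ (L : ℤ)))
      = Ad (hol V ((L : ℤ) • y) (seg κ (L : ℤ))) (ψ (faceSite L y κ) κ) := by
  have hrκ : (r κ : ℕ) < L := (r κ).isLt
  have h := dhol_seg_single V (ψ := ψ) ((L : ℤ) • y + boxVec L r) κ (k := L) (j₀ := L - 1 - r κ) (by omega)
    fun j hj hne => hψ _ _ fun hf => hne ?_
  · rw [h, ← Ad_mul, boxVec_of_onAxis hr, B8Lemma1NonAbelian.treeWord_zsmul_e, add_assoc, ← add_smul]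
    have e1 : ((r κ : ℕ) : ℤ) + ((L - 1 - (r κ : ℕ) : ℕ) : ℤ) = (L : ℤ) - 1 := by omega
    have e2 : hol V ((L : ℤ) • y) (seg κ ((r κ : ℕ) : ℤ))
        * hol V ((L : ℤ) • y + ((r κ : ℕ) : ℤ) • e κ) (seg κ (((L - 1 - (r κ : ℕ) : ℕ) : ℤ) + 1))
        = hol V ((L : ℤ) • y) (seg κ (L : ℤ)) := by
      rw [show (((L - 1 - (r κ : ℕ) : ℕ) : ℤ) + 1) = ((L - (r κ : ℕ) : ℕ) : ℤ) by omega, seg_natCast, seg_natCast,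
        ← disp_seg κ ((r κ : ℕ) : ℤ), seg_natCast, ← hol_append, ← List.replicate_add,
        show (r κ : ℕ) + (L - (r κ : ℕ)) = L by omega, ← seg_natCast]
    rw [e1, e2]
    rfl
  · have hb : ((L : ℤ) • y + boxVec L r + (j : ℤ) • e κ, κ) ∈ bondsOf ((L : ℤ) • y + boxVec L r) (seg κ (L : ℤ)) :=
      (mem_bondsOf_seg_iff _ κ L _).mpr ⟨j, hj, rfl⟩
    have := (face_of_mem_seg hL y κ r hb hf).2
    simp only [Prod.mk.injEq, and_true, faceSite, add_assoc, add_right_inj] at this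
    have := congr_fun this κ
    simp only [Pi.add_apply, Pi.smul_apply, e_apply, if_true, smul_eq_mul, mul_one, boxVec] at this
    omega

/-- The reversed central contour: `(δ_ψV)(−Γ_c from Ly + Le_κ) = −ψ(b₀)`. [folklore] -/
theorem dhol_back {L : ℕ} {V : Site d → Fin d → 𝕄ˣ} {ψ : Site d → Fin d → 𝕄} (hL : 1 ≤ L) (hψ : FaceSupported L ψ) (y : Site d) (κ : Fin d) :
    dhol V ψ ((L : ℤ) • y + (L : ℤ) • e κ) (seg κ (-(L : ℤ))) = -ψ (faceSite L y κ) κ := by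
  obtain ⟨k, hk⟩ : ∃ k : ℕ, L = k + 1 := ⟨L - 1, by omega⟩
  have h := dhol_seg_neg_head V (ψ := ψ) ((L : ℤ) • y + (L : ℤ) • e κ) κ k fun j hj => hψ _ _ fun hf => ?_
  · rw [hk] at h ⊢
    rw [h]
    congr 2
    simp only [faceSite]
    push_cast
    module
  · have hj' : j + 1 < L := by omega
    have := face_of_mem_back hL y κ hj' (by
      rw [show (((j + 1 : ℕ) : ℤ) + 1) • e κ = ((j : ℤ) + 2) • e κ by push_cast; ring_nf]; exact hf)
    omega

/-- **THE LOOP `Γ_{c,x} ∪ (−Γ_c)`**: `(δ_ψV)(loop) = χ_x·Ad_{V(Γ_c)}ψ(b₀) − Ad_{V(Γ_{c,x})}ψ(b₀)`, `χ_x = [x on the axis of c]`.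
[cite: Balaban1985Averaging, (42) p.23] -/
theorem dhol_loopWord {L : ℕ} {V : Site d → Fin d → 𝕄ˣ} {ψ : Site d → Fin d → 𝕄} (hL : 1 ≤ L) (hψ : FaceSupported L ψ) (y : Site d) (κ : Fin d) (r : Fin d → Fin L) :
    dhol V ψ ((L : ℤ) • y) (loopWord L κ (boxVec L r))
      = (if OnAxis κ r then (1 : ℝ) else 0) • Ad (hol V ((L : ℤ) • y) (seg κ (L : ℤ))) (ψ (faceSite L y κ) κ)
        - Ad (hol V ((L : ℤ) • y) (gammaWord L κ (boxVec L r))) (ψ (faceSite L y κ) κ) := by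
  -- the loop = (tree ++ seg) ++ revtree ++ back
  rw [loopWord, dhol_append, disp_gammaWord, dhol_back hL hψ y κ, Ad_neg, ← sub_eq_add_neg]
  congr 1
  rw [gammaWord, dhol_append, disp_append, disp_treeWord, disp_seg]
  -- the reversed tree word vanishes
  have hrev : dhol V ψ ((L : ℤ) • y + (boxVec L r + (L : ℤ) • e κ)) (revWord (treeWord (boxVec L r))) = 0 := by
    have h := dhol_revWord V ψ ((L : ℤ) • y + (L : ℤ) • e κ) (treeWord (boxVec L r))
    rw [disp_treeWord, show (L : ℤ) • y + (L : ℤ) • e κ + boxVec L r = (L : ℤ) • y + (boxVec L r + (L : ℤ) • e κ)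
      by abel] at h
    rw [h, show (L : ℤ) • y + (L : ℤ) • e κ = (L : ℤ) • (y + e κ) by rw [smul_add],
      dhol_treeWord_eq_zero hL hψ (y + e κ) r, Ad_zero, neg_zero]
  rw [hrev, Ad_zero, add_zero, dhol_append, disp_treeWord, dhol_treeWord_eq_zero hL hψ y r, zero_add]
  by_cases hr : OnAxis κ r
  · rw [if_pos hr, one_smul, dhol_seg_onAxis hL hψ y κ hr]
  · rw [if_neg hr, zero_smul, dhol_seg_offAxis hL hψ y κ hr, Ad_zero]

/-- **DRESSED FORM**: with `W = V(Γ_{c,x})V(Γ_c)⁻¹`, `Ad_{W⁻¹}(δ_ψV)(loop) = χ_x·Ad_{W⁻¹}(Ad_{V(Γ_c)}ψ(b₀)) − Ad_{V(Γ_c)}ψ(b₀)`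
(`W⁻¹V(Γ_{c,x}) = V(Γ_c)`). [cite: Balaban1985Averaging, (42) p.23] -/
theorem Ad_inv_Wcx_dhol_loopWord {L : ℕ} {V : Site d → Fin d → 𝕄ˣ} {ψ : Site d → Fin d → 𝕄} (hL : 1 ≤ L) (hψ : FaceSupported L ψ) (y : Site d) (κ : Fin d)
    (r : Fin d → Fin L) :
    Ad (Wcx L V ((L : ℤ) • y) κ (boxVec L r))⁻¹ (dhol V ψ ((L : ℤ) • y) (loopWord L κ (boxVec L r)))
      = (if OnAxis κ r then (1 : ℝ) else 0)
          • Ad (Wcx L V ((L : ℤ) • y) κ (boxVec L r))⁻¹ (Ad (hol V ((L : ℤ) • y) (seg κ (L : ℤ))) (ψ (faceSite L y κ) κ))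
        - Ad (hol V ((L : ℤ) • y) (seg κ (L : ℤ))) (ψ (faceSite L y κ) κ) := by
  rw [dhol_loopWord hL hψ y κ r, Ad_sub, Ad_real_smul]
  congr 1
  rw [← Ad_mul]
  congr 1
  rw [Wcx, mul_inv_rev, inv_inv, mul_assoc, inv_mul_cancel, mul_one]

/-! ## §4 The push-forward of a face-supported direction -/

/-- **`Φ(c) = m + Ad_{V(Γ_c)⁻¹} J_{X_c}(X_c′)`** for a face-supported `ψ`, `m = ψ(b₀(c))`. [cite: Balaban1985Averaging, (42) p.23] -/
theorem pushDir_faceSupported {L : ℕ} {V : Site d → Fin d → 𝕄ˣ} {ψ : Site d → Fin d → 𝕄} (hL : 1 ≤ L) (hψ : FaceSupported L ψ) (y : Site d) (κ : Fin d) :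
    pushDir L V ψ ((L : ℤ) • y) κ
      = ψ (faceSite L y κ) κ
        + Ad (hol V ((L : ℤ) • y) (seg κ (L : ℤ)))⁻¹
            (jexp (Xavg L V ((L : ℤ) • y) κ) (XavgDeriv L V ψ ((L : ℤ) • y) κ)) := by
  rw [pushDir, sideDeriv, dhol_central hL hψ y κ, ← Ad_mul, Ad_add, ← Ad_mul]
  have e1 : (bavg L V ((L : ℤ) • y) κ)⁻¹ * expUnit (Xavg L V ((L : ℤ) • y) κ) * hol V ((L : ℤ) • y) (seg κ (L : ℤ))
      = 1 := by
    rw [bavg]; group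
  have e2 : (bavg L V ((L : ℤ) • y) κ)⁻¹ * expUnit (Xavg L V ((L : ℤ) • y) κ)
      = (hol V ((L : ℤ) • y) (seg κ (L : ℤ)))⁻¹ := by
    rw [bavg]; group
  rw [e1, e2, Ad_one, add_comm]

end

end Summit.QuantumFields.BalabanUV.T4Continuum.AveragingDeficitFaceWords
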